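import Mathlib
import HarnessLib
import Summits.Ventures.LatticeQCDFlow.Exactness.SUNStoutLayerJacobian
import Summits.Ventures.LatticeQCDFlow.Exactness.NCPLayerEquiv

/-!
# A SCHEDULE of masked `SU(N)` stout layers (the engine's residual flow) is an exact measurable automorphism with a pinched Jacobian, for every `N`

HONEST FRAMING: exact (Metropolis-corrected) sampling algorithms for lattice gauge theory;
figures of merit are autocorrelation/cost numbers at stated couplings and volumes; no
continuum-physics claim.

Venture `LatticeQCDFlow` (cell pub-lqcd), topic `Exactness`; FANOUT row 10 (`eng-equiv`: the engine's
`flows_jax/residual_flow.py` / `equiv/residual.py` residual FLOW = a finite schedule of masked stout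
layers cycling through direction masks, log-dets accumulated along the schedule).  NEW WORK of the
cell composing this row's single-layer certificate (`SUNStoutLayerJacobian.exists_stoutLayer_fthmc_data`)
with row 14's list composition `NCPLayerEquiv.hasJacobian_foldr_trans`.  No definition is introduced.

* `exists_fthmc_data_foldr` — generic: a list of measurable automorphisms, each with a measurable
  Jacobian pinched between positive constants, composes (head first) to a measurable automorphism
  whose accumulated Jacobian (the running product the engine sums in log form) is measurable and
  pinched between positive constants;
* **`exists_stoutSchedule_fthmc_data`** — for every finite schedule `sched : List ι` indexing a family
  of (mask, parameter) pairs `ps i`, `rs i`, each mask meeting the frozen-staple hypotheses h1–h6 and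
  each parameter with `2(d−1)|rs i| < 1`: `∃ Ψ J j₁ j₂`, `⇑Ψ =` the composite of the stout steps (head of the list first),
  `J` measurable, `0 < j₁ ≤ J ≤ j₂`, `HasJacobian (⊗_e Haar_{SU(n)}) Ψ (ofReal ∘ J)` — so row 14's
  FT-HMC theorems (`SUNLeapfrogFTHMCErgodic.engine_sunLeapfrogFTHMC_*`) and the flow-sampler
  ergodicity argument of `SUNStoutFlowSamplerErgodic` apply verbatim to the whole residual flow,
  every `N`, `d`, `L ≥ 1`.

Printed counterparts, NAMED ONLY: Abbott et al., arXiv:2305.02402 §4.2; Morningstar–Peardon, PRD 69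
(2004) 054501; M. Lüscher, CMP 293 (2010) 899.
-/

noncomputable section

namespace Summit.Ventures.LatticeQCDFlow.Exactness

open Literature.MathematicalPhysics.QuantumFieldTheory
open Literature.MathematicalPhysics.QuantumFieldTheory.Luscher2010
open MeasureTheory Filter Set
open scoped Matrix Matrix.Norms.Frobenius Topology ENNReal

/-! ## Generic: pinched Jacobians compose to pinched Jacobians -/

/-- **Composition of certified layers with pinched Jacobians.**  For a list of measurable
automorphisms `Ψ_k` with `HasJacobian vol Ψ_k (ofReal ∘ J_k)`, `J_k` measurable and
`0 < a_k ≤ J_k ≤ b_k`, the composite (head first) is a measurable automorphism with a measurable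
Jacobian pinched between positive constants. -/
theorem exists_fthmc_data_foldr {Ω : Type*} [MeasurableSpace Ω] {vol : Measure Ω}
    (layers : List ((Ω ≃ᵐ Ω) × (Ω → ℝ)))
    (hmeas : ∀ L ∈ layers, Measurable L.2)
    (hpinch : ∀ L ∈ layers, ∃ a b : ℝ, 0 < a ∧ (∀ v, a ≤ L.2 v) ∧ (∀ v, L.2 v ≤ b))
    (hjac : ∀ L ∈ layers, HasJacobian vol L.1 fun v => ENNReal.ofReal (L.2 v)) :
    ∃ (J : Ω → ℝ) (j₁ j₂ : ℝ), Measurable J ∧ 0 < j₁ ∧ (∀ v, j₁ ≤ J v) ∧ (∀ v, J v ≤ j₂) ∧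
      HasJacobian vol ⇑(layers.foldr (fun L (G : Ω ≃ᵐ Ω) => L.1.trans G) (MeasurableEquiv.refl Ω))
        fun v => ENNReal.ofReal (J v) := by
  have hpos : ∀ L ∈ layers, ∀ v, 0 < L.2 v := by
    intro L hL v
    obtain ⟨a, b, ha, hav, -⟩ := hpinch L hL
    exact ha.trans_le (hav v)
  obtain ⟨-, hJm, hJ⟩ := hasJacobian_foldr_trans (vol := vol) layers hpos hmeas hjac
  -- pinching of the accumulated product, by induction on the list
  have hbounds : ∃ j₁ j₂ : ℝ, 0 < j₁ ∧
      (∀ v, j₁ ≤ layers.foldr (fun L K => fun v => L.2 v * K (L.1 v)) (fun _ => (1 : ℝ)) v) ∧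
      (∀ v, layers.foldr (fun L K => fun v => L.2 v * K (L.1 v)) (fun _ => (1 : ℝ)) v ≤ j₂) := by
    clear hJm hJ
    induction layers with
    | nil => exact ⟨1, 1, one_pos, fun v => le_rfl, fun v => le_rfl⟩
    | cons L rest ih =>
      obtain ⟨j₁, j₂, hj₁, hlo, hhi⟩ := ih (fun L' hL' => hmeas L' (List.mem_cons_of_mem _ hL'))
        (fun L' hL' => hpinch L' (List.mem_cons_of_mem _ hL'))
        (fun L' hL' => hjac L' (List.mem_cons_of_mem _ hL'))
        (fun L' hL' => hpos L' (List.mem_cons_of_mem _ hL'))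
      obtain ⟨a, b, ha, hav, hvb⟩ := hpinch L List.mem_cons_self
      refine ⟨a * j₁, b * j₂, mul_pos ha hj₁, fun v => ?_, fun v => ?_⟩
      · simp only [List.foldr_cons]
        exact mul_le_mul (hav v) (hlo _) hj₁.le ((ha.le).trans (hav v))
      · simp only [List.foldr_cons]
        exact mul_le_mul (hvb v) (hhi _) (hj₁.le.trans (hlo _)) ((ha.le.trans (hav v)).trans (hvb v))
  obtain ⟨j₁, j₂, hj₁, hlo, hhi⟩ := hbounds
  exact ⟨_, j₁, j₂, hJm, hj₁, hlo, hhi, hJ⟩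

/-! ## The engine's residual flow: a schedule of masked stout steps -/

variable {d L n : ℕ} [NeZero L]

/-- **A finite schedule of masked `SU(N)` stout steps is an exact measurable automorphism with a
pinched measurable Jacobian** — the data `Ψ, J, j₁, j₂` of row 14's FT-HMC theorems and of the
flow-sampler ergodicity argument, for the whole residual flow.  The schedule is a list of indices
into a family of (mask, parameter) pairs (the engine cycles through a fixed set of direction masks);
the head of the list is applied first. -/
theorem exists_stoutSchedule_fthmc_data {ι : Type*} (ps : ι → Edge d L → Prop)
    [∀ i, DecidablePred (ps i)] (rs : ι → ℝ) (sched : List ι)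
    (h1 : ∀ i e, ps i e → ∀ ν, ν ≠ e.2 → ¬ps i (e.1.shift e.2, ν))
    (h2 : ∀ i e, ps i e → ∀ ν, ν ≠ e.2 → ¬ps i (e.1.shift ν, e.2))
    (h3 : ∀ i e, ps i e → ∀ ν, ν ≠ e.2 → ¬ps i (e.1, ν))
    (h4 : ∀ i e, ps i e → ∀ ν, ν ≠ e.2 → ¬ps i ((e.1 - Pi.single ν 1).shift e.2, ν))
    (h5 : ∀ i e, ps i e → ∀ ν, ν ≠ e.2 → ¬ps i (e.1 - Pi.single ν 1, e.2))
    (h6 : ∀ i e, ps i e → ∀ ν, ν ≠ e.2 → ¬ps i (e.1 - Pi.single ν 1, ν))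
    (hr : ∀ i, 2 * (d - 1 : ℝ) * |rs i| < 1) :
    ∃ (Ψ : GaugeConfig d L (Matrix.specialUnitaryGroup (Fin n) ℂ) ≃ᵐ
        GaugeConfig d L (Matrix.specialUnitaryGroup (Fin n) ℂ))
      (J : GaugeConfig d L (Matrix.specialUnitaryGroup (Fin n) ℂ) → ℝ) (j₁ j₂ : ℝ),
      (⇑Ψ = sched.foldr (fun i (G : GaugeConfig d L (Matrix.specialUnitaryGroup (Fin n) ℂ) →
          GaugeConfig d L (Matrix.specialUnitaryGroup (Fin n) ℂ)) =>
        G ∘ fun (V : GaugeConfig d L (Matrix.specialUnitaryGroup (Fin n) ℂ)) (e : Edge d L) =>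
          if ps i e then
            (⟨NormedSpace.exp ((rs i : ℂ) • suProj (plaquetteLoopSum V e.1 e.2)),
                exp_smul_suProj_mem (rs i) (plaquetteLoopSum V e.1 e.2)⟩ :
              Matrix.specialUnitaryGroup (Fin n) ℂ) * V e
          else V e) id) ∧
      Measurable J ∧ 0 < j₁ ∧ (∀ v, j₁ ≤ J v) ∧ (∀ v, J v ≤ j₂) ∧
      HasJacobian (Measure.pi fun _ : Edge d L => haarProbability (Matrix.specialUnitaryGroup (Fin n) ℂ))
        Ψ (fun v => ENNReal.ofReal (J v)) := by
  induction sched with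
  | nil =>
    refine ⟨MeasurableEquiv.refl _, fun _ => 1, 1, 1, rfl, measurable_const, one_pos, fun _ => le_rfl,
      fun _ => le_rfl, ?_⟩
    have h := hasJacobian_id (Measure.pi fun _ : Edge d L => haarProbability (Matrix.specialUnitaryGroup (Fin n) ℂ))
    simp only [ENNReal.ofReal_one]
    exact h
  | cons i rest ih =>
    obtain ⟨Ψr, Jr, a₁, a₂, hΨr, hJrm, ha₁, hJr₁, hJr₂, hJr⟩ := ih
    obtain ⟨Ψl, Jl, b₁, b₂, hΨl, hJlm, hb₁, hJl₁, hJl₂, hJl⟩ :=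
      exists_stoutLayer_fthmc_data (n := n) (ps i) (rs i) (h1 i) (h2 i) (h3 i) (h4 i) (h5 i) (h6 i) (hr i)
    obtain ⟨J, j₁, j₂, hJm, hj₁, hlo, hhi, hJ⟩ := exists_fthmc_data_foldr
      (vol := Measure.pi fun _ : Edge d L => haarProbability (Matrix.specialUnitaryGroup (Fin n) ℂ))
      [(Ψl, Jl), (Ψr, Jr)]
      (by intro L hL; simp only [List.mem_cons, List.mem_nil_iff, or_false] at hL
          rcases hL with rfl | rfl <;> assumption)
      (by intro L hL; simp only [List.mem_cons, List.mem_nil_iff, or_false] at hL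
          rcases hL with rfl | rfl
          · exact ⟨b₁, b₂, hb₁, hJl₁, hJl₂⟩
          · exact ⟨a₁, a₂, ha₁, hJr₁, hJr₂⟩)
      (by intro L hL; simp only [List.mem_cons, List.mem_nil_iff, or_false] at hL
          rcases hL with rfl | rfl <;> assumption)
    refine ⟨Ψl.trans (Ψr.trans (MeasurableEquiv.refl _)), J, j₁, j₂, ?_, hJm, hj₁, hlo, hhi, ?_⟩
    · simp only [List.foldr_cons]
      rw [← hΨr, ← hΨl, MeasurableEquiv.coe_trans, MeasurableEquiv.coe_trans]
      rfl
    · simpa only [List.foldr_cons, List.foldr_nil] using hJ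

end Summit.Ventures.LatticeQCDFlow.Exactness

end
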